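import Literature.LinearAlgebra.FreeModule.AlternatingElementaryDivisors
import HarnessLib

/-!
# An integral Frobenius frame for a rational alternating form

Let `U` be a finite-dimensional `ℚ`-vector space with a basis `c : Basis N ℚ U` and let `ψ` be a
nondegenerate alternating bilinear form on `U`.  The `ℤ`-span `Λ` of `c` is a full lattice, and
some positive multiple `n • ψ` is `ℤ`-valued on `Λ`.  Frobenius' normal form
(`exists_frobeniusBasis_toMatrix`) then provides a `ℤ`-basis of `Λ` in which `n • ψ` has matrix
`( 0 D ; -D 0 )`, `D = diag(d₁ ∣ d₂ ∣ ⋯ ∣ d_g)`.  We record this in coordinates: there is an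
integer matrix `T`, invertible over `ℤ`, such that
`n · ψ(v, w) = (T c⁎v) ⬝ ( 0 D ; -D 0 ) (T c⁎w)` where `c⁎v` are the `c`-coordinates of `v`.
This is the linear-algebra core of the construction of an integral symplectic frame adapted to a
lattice [cite: AdkinsWeintraub1992, Ch. 6 Thm. 2.35 (p. 361)], [cite: Lang2002, XV §8].
-/

open Matrix

namespace Literature.LinearAlgebra.FreeModule

/-- Clearing denominators: finitely many rationals have a common positive integer multiple that
makes all of them integral. [cite: Lang2002, XV §8] -/
theorem exists_nat_pos_mul_integral {ι : Type*} [Finite ι] (f : ι → ℚ) :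
    ∃ m : ℕ, 0 < m ∧ ∃ z : ι → ℤ, ∀ i, (m : ℚ) * f i = z i := by
  classical
  haveI : Fintype ι := Fintype.ofFinite ι
  refine ⟨∏ i, (f i).den, Finset.prod_pos fun i _ => (f i).den_pos, ?_⟩
  have hdvd : ∀ i, (f i).den ∣ ∏ k, (f k).den := fun i =>
    Finset.dvd_prod_of_mem (fun k => (f k).den) (Finset.mem_univ i)
  refine ⟨fun i => (f i).num * (((∏ k, (f k).den) / (f i).den : ℕ) : ℤ), fun i => ?_⟩
  obtain ⟨e, he⟩ := hdvd i
  dsimp only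
  rw [he, Nat.mul_div_cancel_left _ (f i).den_pos]
  push_cast
  have := Rat.mul_den_eq_num (f i)
  calc ((f i).den : ℚ) * e * f i = (f i * (f i).den) * e := by ring
    _ = (f i).num * e := by rw [this]

variable {U : Type*} [AddCommGroup U] [Module ℚ U] {N : Type*} [Fintype N] [DecidableEq N]

/-- **Integral Frobenius frame.**  For a nondegenerate alternating form `ψ` on a `ℚ`-space with
basis `c`, there are `n > 0`, a type `d = (d₁ ∣ ⋯ ∣ d_g)` of positive integers and an integer
matrix `T`, invertible over `ℤ` (inverse `T'`), with
`n · ψ(v, w) = (T · c⁎v) ⬝ ( 0 D ; -D 0 ) · (T · c⁎w)` for all `v w`, where `c⁎` denotes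
`c`-coordinates; in other words the columns of `T⁻¹` are the `c`-coordinates of a `ℤ`-basis of the
lattice spanned by `c` in which `n • ψ` is in Frobenius normal form.
[cite: AdkinsWeintraub1992, Ch. 6 Thm. 2.35 (p. 361)] -/
theorem exists_integral_frobenius_frame (c : Module.Basis N ℚ U) (ψ : LinearMap.BilinForm ℚ U)
    (halt : ∀ v, ψ v v = 0) (hnd : ψ.Nondegenerate) :
    ∃ (n g : ℕ) (d : Fin g → ℕ) (T : Matrix (Fin g ⊕ Fin g) N ℤ) (T' : Matrix N (Fin g ⊕ Fin g) ℤ),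
      0 < n ∧ Fintype.card N = g + g ∧ (∀ i, 0 < d i) ∧ (∀ i j, i ≤ j → d i ∣ d j) ∧
      T * T' = 1 ∧ T' * T = 1 ∧
      ∀ v w : U, (n : ℚ) * ψ v w =
        (T.map (Int.cast : ℤ → ℚ) *ᵥ c.equivFun v) ⬝ᵥ
          ((Matrix.fromBlocks 0 (Matrix.diagonal fun i => (d i : ℤ))
              (-Matrix.diagonal fun i => (d i : ℤ)) 0).map (Int.cast : ℤ → ℚ) *ᵥ
            (T.map (Int.cast : ℤ → ℚ) *ᵥ c.equivFun w)) := by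
  classical
  -- Step 1: an integral multiple of the Gram matrix.
  set G₀ : Matrix N N ℚ := LinearMap.BilinForm.toMatrix c ψ with hG₀
  obtain ⟨n, hn, z, hz⟩ := exists_nat_pos_mul_integral (fun p : N × N => G₀ p.1 p.2)
  let G : Matrix N N ℤ := fun i k => z (i, k)
  have hG : G.map (Int.cast : ℤ → ℚ) = (n : ℚ) • G₀ := by
    ext i k
    simp only [map_apply, Matrix.smul_apply, smul_eq_mul, G]
    exact (hz (i, k)).symm
  -- coordinates
  have hψ : ∀ v w : U, ψ v w = c.equivFun v ⬝ᵥ G₀ *ᵥ c.equivFun w := fun v w => by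
    rw [hG₀]
    exact LinearMap.BilinForm.apply_eq_dotProduct_toMatrix_mulVec c ψ v w
  -- Step 2: the integral form on `N → ℤ`.
  let E : LinearMap.BilinForm ℤ (N → ℤ) := Matrix.toBilin' G
  have hEcast : ∀ x y : N → ℤ, ((E x y : ℤ) : ℚ) =
      (n : ℚ) * ψ (c.equivFun.symm (fun i => (x i : ℚ))) (c.equivFun.symm (fun i => (y i : ℚ))) := by
    intro x y
    rw [hψ, LinearEquiv.apply_symm_apply, LinearEquiv.apply_symm_apply]
    change ((Matrix.toBilin' G x y : ℤ) : ℚ) = _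
    have h1 : ((Matrix.toBilin' G x y : ℤ) : ℚ) =
        (fun i => (x i : ℚ)) ⬝ᵥ G.map (Int.cast : ℤ → ℚ) *ᵥ (fun i => (y i : ℚ)) := by
      rw [Matrix.toBilin'_apply',
        show ((x ⬝ᵥ G *ᵥ y : ℤ) : ℚ) = Int.castRingHom ℚ (x ⬝ᵥ G *ᵥ y) from rfl,
        RingHom.map_dotProduct]
      congr 1
      funext i
      simp only [Function.comp_apply, Int.coe_castRingHom, Matrix.mulVec, dotProduct, Matrix.map_apply,
        Int.cast_sum, Int.cast_mul]
    rw [h1, hG, Matrix.smul_mulVec, dotProduct_smul, smul_eq_mul]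
  have hA : E.IsAlt := by
    intro x
    have h := hEcast x x
    rw [halt, mul_zero] at h
    exact_mod_cast h
  have hL : LinearMap.SeparatingLeft (E : (N → ℤ) →ₗ[ℤ] (N → ℤ) →ₗ[ℤ] ℤ) := by
    intro x hx
    set u : U := c.equivFun.symm (fun i => (x i : ℚ)) with hu
    have hu0 : u = 0 := by
      refine hnd.1 u fun w => ?_
      obtain ⟨m, hm, y, hy⟩ := exists_nat_pos_mul_integral (c.equivFun w)
      have hw : c.equivFun.symm (fun i => (y i : ℚ)) = (m : ℚ) • w := by
        have : (fun i => (y i : ℚ)) = (m : ℚ) • c.equivFun w := funext fun i => by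
          rw [Pi.smul_apply, smul_eq_mul, hy]
        rw [this, map_smul, LinearEquiv.symm_apply_apply]
      have h := hEcast x y
      rw [hx y, hw, map_smul, smul_eq_mul, Int.cast_zero] at h
      have hm' : (m : ℚ) ≠ 0 := Nat.cast_ne_zero.mpr hm.ne'
      have hn' : (n : ℚ) ≠ 0 := Nat.cast_ne_zero.mpr hn.ne'
      have : (n : ℚ) * ((m : ℚ) * ψ u w) = 0 := h.symm
      simpa [hm', hn'] using this
    have hx' : (fun i => (x i : ℚ)) = 0 := by
      have := congrArg c.equivFun hu0
      rwa [hu, LinearEquiv.apply_symm_apply, map_zero] at this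
    funext i
    have := congrFun hx' i
    rw [Pi.zero_apply] at this
    rw [Pi.zero_apply]
    exact_mod_cast this
  have hN : E.Nondegenerate :=
    ⟨hL, fun y hy => hL y fun x' => by rw [← hA.neg_eq, hy x', neg_zero]⟩
  -- Step 3: Frobenius normal form.
  obtain ⟨g, b, d, hdpos, hchain, hmat⟩ := exists_frobeniusBasis_toMatrix E hA hN
  set Φ : Matrix (Fin g ⊕ Fin g) (Fin g ⊕ Fin g) ℤ := Matrix.fromBlocks 0
    (Matrix.diagonal fun i => (d i : ℤ)) (-Matrix.diagonal fun i => (d i : ℤ)) 0 with hΦ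
  let T : Matrix (Fin g ⊕ Fin g) N ℤ := b.toMatrix (Pi.basisFun ℤ N)
  let T' : Matrix N (Fin g ⊕ Fin g) ℤ := (Pi.basisFun ℤ N).toMatrix b
  have hTT' : T * T' = 1 := by
    simp only [T, T']
    rw [Module.Basis.toMatrix_mul_toMatrix, Module.Basis.toMatrix_self]
  have hT'T : T' * T = 1 := by
    simp only [T, T']
    rw [Module.Basis.toMatrix_mul_toMatrix, Module.Basis.toMatrix_self]
  -- the Gram matrix in the standard basis is `G = Tᵀ Φ T`
  have hGT : G = Tᵀ * Φ * T := by
    have h1 := LinearMap.BilinForm.toMatrix_mul_basis_toMatrix b (Pi.basisFun ℤ N) E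
    rw [hmat, LinearMap.BilinForm.toMatrix_basisFun, LinearMap.BilinForm.toMatrix'_toBilin'] at h1
    exact h1.symm
  have hcard : Fintype.card N = g + g := by
    have h1 := Module.finrank_eq_card_basis b
    rw [Module.finrank_fintype_fun_eq_card, Fintype.card_sum, Fintype.card_fin] at h1
    exact h1
  refine ⟨n, g, d, T, T', hn, hcard, hdpos, hchain, hTT', hT'T, fun v w => ?_⟩
  -- Step 4: the coordinate identity over `ℚ`.
  have hGq : (n : ℚ) • G₀ = (T.map (Int.cast : ℤ → ℚ))ᵀ * Φ.map (Int.cast : ℤ → ℚ) *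
      T.map (Int.cast : ℤ → ℚ) := by
    rw [← hG, hGT]
    ext i k
    simp only [Matrix.map_apply, Matrix.mul_apply, Matrix.transpose_apply, Int.cast_sum, Int.cast_mul]
  rw [hψ, ← smul_eq_mul, ← dotProduct_smul, ← Matrix.smul_mulVec, hGq, ← Matrix.mulVec_mulVec,
    ← Matrix.mulVec_mulVec, Matrix.dotProduct_mulVec, Matrix.vecMul_transpose]

end Literature.LinearAlgebra.FreeModule
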